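import Literature.AlgebraicGeometry.Motives.HyperbolicWeilTypeProduct
import Literature.AlgebraicGeometry.Motives.SegreHyperplaneClass
import Literature.AlgebraicGeometry.Motives.PolarizationPairingProduct
import Literature.AlgebraicGeometry.Motives.AbelianVarietyProductDimProofs
import HarnessLib

/-!
# Hyperbolic × hyperbolic is hyperbolic under the Segre embedding (stub `stub_hypProd` of crux `HyperbolicEightfoldsSqrtMinus7`)

Route `HeckePrymWeil` (sub-problem `HodgeConjecture`), crux `HyperbolicEightfoldsSqrtMinus7`
(stmt-HodgeConjecture-14642), line `Sketch`, skeleton v9 ("hyperbolic reach"), registered stub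
`stub_hypProd`, proved by the line lead.

For complex abelian varieties `(A, φ)`, `(B, ψ)` of dimensions `2 n_A`, `2 n_B` (`n_A, n_B ≥ 1`)
embedded by `ι_A : A ↪ ℙᴺ`, `ι_B : B ↪ ℙᴹ`, of HYPERBOLIC Weil type
(`Motives.IsHyperbolicWeilType`: a rational, `φ^*`-stable, `2n`-frame of `H¹` Lagrangian for the
polarization pairing `Q_h = h^{2n-1} ⌣ (· ⌣ ·)`) for the `K`-symmetrised hyperplane classes
`d·θ_A + φ^*θ_A`, `d·θ_B + ψ^*θ_B` (`θ = ι^* g` for a Segre-additive family `g` of hyperplane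
classes), the product `(A × B, φ × ψ)` is of hyperbolic Weil type in half-dimension `n_A + n_B` for
the `K`-symmetrised hyperplane class of the Segre embedding `(ι_A ⊗ ι_B) ≫ σ_{N,M}`. Proof: that
class is `pr_A^* h_A + pr_B^* h_B` (`σ^* g = pr₁^* g + pr₂^* g`, naturality, `(φ × ψ)^* pr^* = pr^* φ^*`);
the frame is the union of the pulled-back frames (rational; `ℂ`-independent by Künneth in degree
one; stable); its Gram matrix for `Q_{pr_A^* h_A + pr_B^* h_B}` is block-diagonal with diagonal
blocks multiples of the factors' (vanishing) pairings and vanishing mixed blocks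
(`Motives/PolarizationPairingProduct`). Van Geemen's "`det H` is multiplicative" (LNM 1594,
Lemma 5.2 (3)): hyperbolic ⊕ hyperbolic is hyperbolic. No `sorry`, no new definition.
-/

noncomputable section

set_option linter.dupNamespace false

open CategoryTheory MonoidalCategory CartesianMonoidalCategory AlgebraicGeometry
open Literature.AlgebraicGeometry Literature.AlgebraicGeometry.Motives
  Literature.AlgebraicGeometry.HodgeTheory Literature.AlgebraicTopology.SingularHomology
open Literature.AlgebraicGeometry.Motives.SegreHyperplaneClass

namespace Summit.HodgeConjecture.HodgeConjecture.Theorems.HyperbolicEightfoldsSqrtMinus7.HyperbolicReach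

/-- **The pulled-back frame is mapped into its own span by the product endomorphism** (one factor):
if `φ^* x ∈ ⟨u⟩` then `pr_A^*(φ^* x) ∈ ⟨pr_A^* u ⊔ pr_B^* w⟩`. [folklore] -/
theorem map_mem_span_sumElim_inl {A B : AbelianVariety ℂ} {ιA ιB : Type*}
    (u : ιA → complexBetti A.X 1) (w : ιB → complexBetti B.X 1) {x : complexBetti A.X 1}
    (hx : x ∈ Submodule.span ℂ (Set.range u)) :
    complexBetti.map (AbelianVariety.fst A B).hom.hom.hom 1 x ∈
      Submodule.span ℂ (Set.range (Sum.elim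
        (fun i => complexBetti.map (AbelianVariety.fst A B).hom.hom.hom 1 (u i))
        (fun k => complexBetti.map (AbelianVariety.snd A B).hom.hom.hom 1 (w k)))) := by
  have h1 : complexBetti.map (AbelianVariety.fst A B).hom.hom.hom 1 x ∈
      Submodule.map (complexBetti.map (AbelianVariety.fst A B).hom.hom.hom 1).hom
        (Submodule.span ℂ (Set.range u)) := Submodule.mem_map_of_mem hx
  rw [Submodule.map_span] at h1
  refine Submodule.span_mono ?_ h1
  rintro _ ⟨_, ⟨i, rfl⟩, rfl⟩
  exact ⟨Sum.inl i, rfl⟩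

/-- The same for the second factor: `pr_B^*(ψ^* y) ∈ ⟨pr_A^* u ⊔ pr_B^* w⟩` if `ψ^* y ∈ ⟨w⟩`. [folklore] -/
theorem map_mem_span_sumElim_inr {A B : AbelianVariety ℂ} {ιA ιB : Type*}
    (u : ιA → complexBetti A.X 1) (w : ιB → complexBetti B.X 1) {y : complexBetti B.X 1}
    (hy : y ∈ Submodule.span ℂ (Set.range w)) :
    complexBetti.map (AbelianVariety.snd A B).hom.hom.hom 1 y ∈
      Submodule.span ℂ (Set.range (Sum.elim
        (fun i => complexBetti.map (AbelianVariety.fst A B).hom.hom.hom 1 (u i))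
        (fun k => complexBetti.map (AbelianVariety.snd A B).hom.hom.hom 1 (w k)))) := by
  have h1 : complexBetti.map (AbelianVariety.snd A B).hom.hom.hom 1 y ∈
      Submodule.map (complexBetti.map (AbelianVariety.snd A B).hom.hom.hom 1).hom
        (Submodule.span ℂ (Set.range w)) := Submodule.mem_map_of_mem hy
  rw [Submodule.map_span] at h1
  refine Submodule.span_mono ?_ h1
  rintro _ ⟨_, ⟨k, rfl⟩, rfl⟩
  exact ⟨Sum.inr k, rfl⟩

/-- **Hyperbolic ⊕ hyperbolic is hyperbolic, frame level.** For `(A, φ)` of dimension `2 n_A` and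
`(B, ψ)` of dimension `2 n_B` (`n_A, n_B ≥ 1`) of hyperbolic Weil type for classes `h_A`, `h_B`, the
product `(A × B, φ × ψ)` is of hyperbolic Weil type in half-dimension `n_A + n_B` for
`pr_A^* h_A + pr_B^* h_B`: the union of the pulled-back frames is rational, `ℂ`-independent (Künneth
in degree one), `(φ × ψ)^*`-stable, and its Gram matrix is block-diagonal with vanishing blocks
(`Motives/PolarizationPairingProduct`). [cite: vanGeemen1994HodgeAV, Lemma 5.2 (2)–(3) and 5.4]
[cite: HatcherAT2002, §3.2 Thm. 3.16] -/
theorem isHyperbolicWeilType_prod_of_isHyperbolicWeilType {A B : AbelianVariety ℂ} {φ : A ⟶ A} {ψ : B ⟶ B}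
    {nA nB : ℕ} (hnA : 0 < nA) (hnB : 0 < nB) (hA : A.dim = 2 * nA) (hB : B.dim = 2 * nB)
    {hA2 : complexBetti A.X 2} {hB2 : complexBetti B.X 2}
    (hhA : IsHyperbolicWeilType A φ nA hA2) (hhB : IsHyperbolicWeilType B ψ nB hB2) :
    IsHyperbolicWeilType (A.prod B)
      (AbelianVariety.prodLift (AbelianVariety.fst A B ≫ φ) (AbelianVariety.snd A B ≫ ψ)) (nA + nB)
      (complexBetti.map (AbelianVariety.fst A B).hom.hom.hom 2 hA2 +
        complexBetti.map (AbelianVariety.snd A B).hom.hom.hom 2 hB2) := by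
  classical
  obtain ⟨u, hur, hui, hus, huq⟩ := hhA
  obtain ⟨w, hwr, hwi, hws, hwq⟩ := hhB
  -- dimension bookkeeping
  have hA' : A.dim = (2 * nA - 1) + 1 := by omega
  have hB' : B.dim = (2 * nB - 1) + 1 := by omega
  have hX : Motives.IsSmoothProjective ((2 * nA - 1) + 1) A.X := isSmoothProjective_of_dim_eq' hA'
  have hY : Motives.IsSmoothProjective ((2 * nB - 1) + 1) B.X := isSmoothProjective_of_dim_eq' hB'
  have hm : 2 * (nA + nB) - 1 = (2 * nA - 1) + (2 * nB - 1) + 1 := by omega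
  set f := (AbelianVariety.fst A B).hom.hom.hom with hf
  set g := (AbelianVariety.snd A B).hom.hom.hom with hg
  -- the pulled-back frame, reindexed by `Fin (2 (n_A + n_B))`
  set U : Fin (2 * nA) ⊕ Fin (2 * nB) → complexBetti (A.prod B).X 1 :=
    Sum.elim (fun i => complexBetti.map f 1 (u i)) (fun k => complexBetti.map g 1 (w k)) with hU
  let e : Fin (2 * nA) ⊕ Fin (2 * nB) ≃ Fin (2 * (nA + nB)) :=
    finSumFinEquiv.trans (finCongr (by ring))
  have hrange : Set.range (U ∘ e.symm) = Set.range U := e.symm.surjective.range_comp U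
  refine ⟨U ∘ e.symm, fun i => ?_, ?_, fun i => ?_, fun i j => ?_⟩
  · -- rationality
    rcases hx : e.symm i with a | b
    · change IsRationalClass (U (e.symm i)); rw [hx]; exact (hur a).map _
    · change IsRationalClass (U (e.symm i)); rw [hx]; exact (hwr b).map _
  · -- `ℂ`-independence (Künneth in degree one)
    exact (linearIndependent_sumElim_map_fst_map_snd hui hwi).comp e.symm e.symm.injective
  · -- stability under `(φ × ψ)^*`
    rw [hrange]
    change complexBetti.map _ 1 (U (e.symm i)) ∈ _
    rcases e.symm i with a | b
    · simp only [hU, Sum.elim_inl]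
      rw [map_prodLift_map_fst]
      exact map_mem_span_sumElim_inl u w (hus a)
    · simp only [hU, Sum.elim_inr]
      rw [map_prodLift_map_snd]
      exact map_mem_span_sumElim_inr u w (hws b)
  · -- isotropy: the block Gram matrix vanishes
    change Motives.polarizationPairingOne _ _ _ (U (e.symm i)) (U (e.symm j)) = 0
    rcases e.symm i with a | b <;> rcases e.symm j with a' | b'
    · simp only [hU, Sum.elim_inl]
      rw [polarizationPairingOne_add_map_map f g hX hY hA2 hB2 hm, huq a a', map_zero,
        LinearMap.map_zero₂, smul_zero]
    · simp only [hU, Sum.elim_inl, Sum.elim_inr]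
      exact polarizationPairingOne_add_map_map_mixed f g hX hY hA2 hB2 hm (u a) (w b')
    · simp only [hU, Sum.elim_inl, Sum.elim_inr]
      exact polarizationPairingOne_add_map_map_mixed' f g hX hY hA2 hB2 hm (u a') (w b)
    · simp only [hU, Sum.elim_inr]
      rw [polarizationPairingOne_add_map_map' f g hX hY hA2 hB2 hm, hwq b b', map_zero, map_zero,
        smul_zero]

/-- **Stub `stub_hypProd` of skeleton v9 of crux `HyperbolicEightfoldsSqrtMinus7` — hyperbolic ×
hyperbolic is hyperbolic for the Segre embedding, in the crux's embedded typing.** For `(A, φ)` of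
dimension `2 n_A` hyperbolic for the `K`-symmetrised class `d·ι_A^* g_N + φ^*(ι_A^* g_N)` and `(B, ψ)` of
dimension `2 n_B` hyperbolic for `d·ι_B^* g_M + ψ^*(ι_B^* g_M)` (`g` any Segre-additive family of classes
on the projective spaces, `n_A, n_B ≥ 1`), the product `(A × B, φ × ψ)` is hyperbolic in half-dimension
`n_A + n_B` for the `K`-symmetrised class of the Segre embedding `(ι_A ⊗ ι_B) ≫ σ_{N,M}`: by additivity
and naturality that class is `pr_A^* h_A + pr_B^* h_B`, and `isHyperbolicWeilType_prod_of_isHyperbolicWeilType`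
applies. [cite: vanGeemen1994HodgeAV, Lemma 5.2 (3) and 5.4] [cite: Hartshorne1977, II Ex. 5.11 and Ex. 5.12] -/
theorem stub_hypProd :
    ∀ (g : (N : ℕ) → complexBetti (projectiveSpace N ℂ) 2),
      (∀ n m : ℕ, complexBetti.map (segreEmbedding n m ℂ) 2 (g (n * m + n + m)) =
        complexBetti.map (fst (projectiveSpace n ℂ) (projectiveSpace m ℂ)) 2 (g n) +
          complexBetti.map (snd (projectiveSpace n ℂ) (projectiveSpace m ℂ)) 2 (g m)) →
    ∀ (A B : AbelianVariety ℂ) (φ : A ⟶ A) (ψ : B ⟶ B) (nA nB : ℕ) (N M : ℕ)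
      (ιA : A.X ⟶ projectiveSpace N ℂ) (ιB : B.X ⟶ projectiveSpace M ℂ) (d : ℕ),
      0 < nA → 0 < nB → A.dim = 2 * nA → B.dim = 2 * nB →
      IsHyperbolicWeilType A φ nA
        ((d : ℂ) • complexBetti.map ιA 2 (g N) + complexBetti.map φ.hom.hom.hom 2 (complexBetti.map ιA 2 (g N))) →
      IsHyperbolicWeilType B ψ nB
        ((d : ℂ) • complexBetti.map ιB 2 (g M) + complexBetti.map ψ.hom.hom.hom 2 (complexBetti.map ιB 2 (g M))) →
      IsHyperbolicWeilType (A.prod B)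
        (AbelianVariety.prodLift (AbelianVariety.fst A B ≫ φ) (AbelianVariety.snd A B ≫ ψ)) (nA + nB)
        ((d : ℂ) • complexBetti.map ((ιA ⊗ₘ ιB) ≫ segreEmbedding N M ℂ : (A.prod B).X ⟶ _) 2 (g (N * M + N + M)) +
          complexBetti.map
            (AbelianVariety.prodLift (AbelianVariety.fst A B ≫ φ) (AbelianVariety.snd A B ≫ ψ)).hom.hom.hom 2
            (complexBetti.map ((ιA ⊗ₘ ιB) ≫ segreEmbedding N M ℂ : (A.prod B).X ⟶ _) 2 (g (N * M + N + M)))) := by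
  intro g hgσ A B φ ψ nA nB N M ιA ιB d hnA hnB hA hB hhA hhB
  -- the hyperplane class of the Segre embedding: `pr_A^* θ_A + pr_B^* θ_B`
  have hθ : complexBetti.map ((ιA ⊗ₘ ιB) ≫ segreEmbedding N M ℂ : (A.prod B).X ⟶ _) 2 (g (N * M + N + M)) =
      complexBetti.map (AbelianVariety.fst A B).hom.hom.hom 2 (complexBetti.map ιA 2 (g N)) +
        complexBetti.map (AbelianVariety.snd A B).hom.hom.hom 2 (complexBetti.map ιB 2 (g M)) := by
    change complexBetti.map ((ιA ⊗ₘ ιB) ≫ segreEmbedding N M ℂ : A.X ⊗ B.X ⟶ _) 2 (g (N * M + N + M)) =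
      complexBetti.map (fst A.X B.X) 2 (complexBetti.map ιA 2 (g N)) +
        complexBetti.map (snd A.X B.X) 2 (complexBetti.map ιB 2 (g M))
    rw [map_comp_apply', hgσ, map_add, map_tensorHom_map_fst, map_tensorHom_map_snd]
  -- `(φ × ψ)^*` of it: `pr_A^* φ^* θ_A + pr_B^* ψ^* θ_B`
  have hΦ : complexBetti.map
      (AbelianVariety.prodLift (AbelianVariety.fst A B ≫ φ) (AbelianVariety.snd A B ≫ ψ)).hom.hom.hom 2
      (complexBetti.map ((ιA ⊗ₘ ιB) ≫ segreEmbedding N M ℂ : (A.prod B).X ⟶ _) 2 (g (N * M + N + M))) =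
      complexBetti.map (AbelianVariety.fst A B).hom.hom.hom 2
          (complexBetti.map φ.hom.hom.hom 2 (complexBetti.map ιA 2 (g N))) +
        complexBetti.map (AbelianVariety.snd A B).hom.hom.hom 2
          (complexBetti.map ψ.hom.hom.hom 2 (complexBetti.map ιB 2 (g M))) := by
    rw [hθ, map_add, map_prodLift_map_fst, map_prodLift_map_snd]
  have key := isHyperbolicWeilType_prod_of_isHyperbolicWeilType hnA hnB hA hB hhA hhB
  convert key using 1
  rw [hΦ, hθ, map_add, map_add, map_smul, map_smul, smul_add]
  abel

end Summit.HodgeConjecture.HodgeConjecture.Theorems.HyperbolicEightfoldsSqrtMinus7.HyperbolicReach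

end
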